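import Summits.AtomisticToContinuum.BoseEinsteinCondensation.Theses.BECHardSphereReduction
import Summits.AtomisticToContinuum.BoseEinsteinCondensation.Theorems.BECHardSphereReductionZeroModeGlue
import Summits.AtomisticToContinuum.BoseEinsteinCondensation.Theorems.BECHardSphereReductionHardSphereScaling
import Summits.AtomisticToContinuum.BoseEinsteinCondensation.Theorems.BECHardSphereReductionHardSphereZeroModeInfraredReduction
import Summits.AtomisticToContinuum.BoseEinsteinCondensation.Theorems.BECHardSphereReductionHardSphereBECDensityMonotoneReductions
import Summits.AtomisticToContinuum.BoseEinsteinCondensation.Theorems.BECHardSphereReductionHardSphereBECStubDiamRightContinuity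
import Summits.AtomisticToContinuum.BoseEinsteinCondensation.Theorems.BECHardSphereReductionHardSphereBECStubLeftLowerSemicontinuousOf
import Summits.AtomisticToContinuum.BoseEinsteinCondensation.Theorems.BECHardSphereReductionHardSphereBECStubOneSidedBaire
import Summits.AtomisticToContinuum.BoseEinsteinCondensation.Theorems.BECHardSphereReductionHardSphereBECStubSmallRatioOf
import HarnessLib

/-!
# Route BECHardSphereReduction — uniformity of dilute box monotonicity in the dilation ratio is free
# (crux `HardSphereBEC`, stmt-AtomisticToContinuum-11885, line `registered`; supports item 11886)

Write `cn(N, L) := condensateNumber HS₁ N L` for the ground-state condensate number of `N` unit hard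
spheres (`HS₁ = ⊤·1_{(-∞,1]}`) in the Dirichlet box of side `L`.  Crux #4 of the route,
`HardSphereBoxMonotone` (stmt-11886), asks for ONE dilute guard `η₀` under which
`cn(N, L₁) ≤ cn(N, L₂)` for all `L₁ ≤ L₂`; its fixed-ratio instances (`L₂ = L₁/a`, one guard
`η₀(a)` per ratio `a`) are the cases `v := HS_a, R := 1` of crux #2 `HardCoreDominates`
(stmt-11884) by the proved scale covariance `HardSphereScaling`, and the audit of
`Theorems/…HardSphereBECDensityMonotoneReductions.lean` (item 3) identified the UNIFORMITY of the
guard in the ratio as the only extra content of 11886 needed by the crux `HardSphereBEC`.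

This file records that the uniformity is free (lead c6 of the crux line, 2026-08-17):

* per-ratio box monotonicity (the registered stub `stub_perRatioBoxMonotone` of
  `Lines/birth.lean`, spelled out in every statement): per-ratio dilute box monotonicity for the ratios of SOME open interval
  `(lo, hi) ⊂ (0, 1)`, no uniformity asked; it follows from 11886
  (`perRatioBoxMonotone_of_hardSphereBoxMonotone`) and from 11884
  (`perRatioBoxMonotone_of_hardCoreDominates`).
* `smallRatioBoxMonotone_of_perRatio` — per-ratio monotonicity on an open interval of ratios
  already gives UNIFORM monotonicity for ALL small ratios `a ∈ (0, a₀]` under one guard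
  `(n+1)N < (aM)³`: the one-sided Baire uniformisation `Birth.stub_smallRatio_of` (p154332) fed
  with the one-sided Baire lemma `Birth.stub_oneSidedBaire` (p153883) and the LEFT
  lower-semicontinuity of `L ↦ cn(N, L)` (`Birth.stub_leftLowerSemicontinuous_of`, p155976, from
  the right-continuity of the hard-sphere ground-state energy in the core diameter,
  `Birth.stub_diamRightContinuity`, p155143) — all unconditional and kernel-checked.
* `intervalPropagation_of_smallRatio` / `intervalPropagation_of_perRatio` — hence below a
  threshold `η₀`, ground-state BEC of unit hard spheres at ONE reduced density `η` propagates to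
  the whole initial interval `(0, a₀³ η]`.
* `hardSphereBEC_body_of_infraredBound_of_perRatio` — consequently the crux body follows from the
  sparse infrared bound (item 11888 weakened, the open kernel) and per-ratio box monotonicity
  alone; in particular from 11888-weak and EITHER of 11886, 11884|hard spheres
  (`smallRatioBoxMonotone_of_hardCoreDominates`).
-/

noncomputable section

namespace Summit.AtomisticToContinuum.BoseEinsteinCondensation.Cruxes.HardSphereBEC

open MeasureTheory ENNReal Filter Literature.MathematicalPhysics.QuantumManyBody.BoseGas
open Summit.AtomisticToContinuum.BoseEinsteinCondensation.Theses.BECHardSphereReduction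
open Summit.AtomisticToContinuum.BoseEinsteinCondensation.Theorems

/-! Throughout, "per-ratio box monotonicity" is the registered stub statement
`∃ lo hi, 0 < lo < hi < 1 ∧ ∀ a ∈ (lo,hi), ∃ η₀ > 0, ∀ N L, N ≤ η₀ L³ → cn(HS₁,N,L) ≤ cn(HS₁,N,L/a)`
and "uniform small-ratio box monotonicity" is
`∃ n a₀, 0 < a₀ ∧ ∀ a ∈ (0,a₀], ∀ N M, (n+1) N < (aM)³ → cn(HS₁,N,aM) ≤ cn(HS₁,N,M)`;
both are spelled out in full in every statement (no auxiliary definitions). -/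

/-! ## The two existing items give per-ratio monotonicity -/

/-- **Item 11886 gives it.** `HardSphereBoxMonotone` (uniform dilute box monotonicity for all
pairs `L₁ ≤ L₂`) gives per-ratio box monotonicity for every ratio `a ∈ (0,1)` with the same guard
(the guard forces `0 ≤ L`, so `L ≤ L/a`); in particular on `(1/4, 1/2)`. [folklore] -/
theorem perRatioBoxMonotone_of_hardSphereBoxMonotone (h : HardSphereBoxMonotone) :
    (∃ lo hi : ℝ, 0 < lo ∧ lo < hi ∧ hi < 1 ∧ ∀ a : ℝ, lo < a → a < hi → ∃ η₀ : ℝ, 0 < η₀ ∧ ∀ (N : ℕ) (L : ℝ), (N : ℝ) ≤ η₀ * L ^ 3 → Literature.MathematicalPhysics.QuantumManyBody.BoseGas.condensateNumber (Set.indicator (Set.Iic 1) (fun _ : ℝ => (⊤ : ENNReal))) N L ≤ Literature.MathematicalPhysics.QuantumManyBody.BoseGas.condensateNumber (Set.indicator (Set.Iic 1) (fun _ : ℝ => (⊤ : ENNReal))) N (L / a)) := by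
  obtain ⟨η₀, hη₀, hmono⟩ := h
  refine ⟨1 / 4, 1 / 2, by norm_num, by norm_num, by norm_num, fun a hlo hhi => ⟨η₀, hη₀, ?_⟩⟩
  intro N L hNL
  have ha : 0 < a := lt_trans (by norm_num) hlo
  have hL : 0 ≤ L := by
    by_contra hneg
    push Not at hneg
    have h3 : η₀ * L ^ 3 < 0 := by
      have : L ^ 3 < 0 := by
        have := Odd.pow_neg (by decide : Odd 3) hneg
        simpa using this
      nlinarith
    linarith [(Nat.cast_nonneg N : (0 : ℝ) ≤ N)]
  have hLa : L ≤ L / a := by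
    rw [le_div_iff₀ ha]
    nlinarith
  exact hmono N L (L / a) hNL hLa

/-- **Item 11884 gives it.** `HardCoreDominates` at `v := HS_a`, `R := 1` (`HS_a` is measurable
and vanishes beyond `1 > a`) gives `cn(HS₁, N, L) ≤ cn(HS_a, N, L)` under `N ≤ η₀(a) L³`, and
`cn(HS_a, N, L) = cn(HS₁, N, L/a)` by the proved scale covariance `HardSphereScaling`
(`hardSphereScaling_proof`); so per-ratio box monotonicity holds for every `a ∈ (0,1)`, in
particular on `(1/4, 1/2)`. [folklore] -/
theorem perRatioBoxMonotone_of_hardCoreDominates (h : HardCoreDominates) :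
    (∃ lo hi : ℝ, 0 < lo ∧ lo < hi ∧ hi < 1 ∧ ∀ a : ℝ, lo < a → a < hi → ∃ η₀ : ℝ, 0 < η₀ ∧ ∀ (N : ℕ) (L : ℝ), (N : ℝ) ≤ η₀ * L ^ 3 → Literature.MathematicalPhysics.QuantumManyBody.BoseGas.condensateNumber (Set.indicator (Set.Iic 1) (fun _ : ℝ => (⊤ : ENNReal))) N L ≤ Literature.MathematicalPhysics.QuantumManyBody.BoseGas.condensateNumber (Set.indicator (Set.Iic 1) (fun _ : ℝ => (⊤ : ENNReal))) N (L / a)) := by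
  refine ⟨1 / 4, 1 / 2, by norm_num, by norm_num, by norm_num, fun a hlo _ => ?_⟩
  have ha : 0 < a := lt_trans (by norm_num) hlo
  have hmeas : Measurable (Set.indicator (Set.Iic a) (fun _ : ℝ => (⊤ : ENNReal))) :=
    measurable_const.indicator measurableSet_Iic
  have hvan : ∀ r : ℝ, 1 < r → Set.indicator (Set.Iic a) (fun _ : ℝ => (⊤ : ENNReal)) r = 0 := by
    intro r hr
    have : r ∉ Set.Iic a := by
      simp only [Set.mem_Iic, not_le]; linarith
    exact Set.indicator_of_notMem this _
  obtain ⟨η₀, hη₀, hdom⟩ := h _ 1 hmeas one_pos hvan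
  refine ⟨η₀, hη₀, fun N L hNL => ?_⟩
  have h1 := hdom N L (by simpa using hNL)
  rwa [hardSphereScaling_proof a L N ha] at h1

/-! ## Uniformity in the ratio is free (one-sided Baire + left lower-semicontinuity) -/

/-- **Uniform small-ratio box monotonicity from per-ratio monotonicity** — the uniformity of the
dilute guard over ratios costs nothing: the Baire uniformisation `Birth.stub_smallRatio_of`
applied to the one-sided Baire lemma `Birth.stub_oneSidedBaire` and to the left
lower-semicontinuity of `L ↦ cn(HS₁, N, L)` (`Birth.stub_leftLowerSemicontinuous_of` ∘
`Birth.stub_diamRightContinuity`), all proved unconditionally in the tree. [folklore] -/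
theorem smallRatioBoxMonotone_of_perRatio
    (h : (∃ lo hi : ℝ, 0 < lo ∧ lo < hi ∧ hi < 1 ∧ ∀ a : ℝ, lo < a → a < hi → ∃ η₀ : ℝ, 0 < η₀ ∧ ∀ (N : ℕ) (L : ℝ), (N : ℝ) ≤ η₀ * L ^ 3 → Literature.MathematicalPhysics.QuantumManyBody.BoseGas.condensateNumber (Set.indicator (Set.Iic 1) (fun _ : ℝ => (⊤ : ENNReal))) N L ≤ Literature.MathematicalPhysics.QuantumManyBody.BoseGas.condensateNumber (Set.indicator (Set.Iic 1) (fun _ : ℝ => (⊤ : ENNReal))) N (L / a))) :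
    (∃ (n : ℕ) (a₀ : ℝ), 0 < a₀ ∧ ∀ a : ℝ, 0 < a → a ≤ a₀ → ∀ (N : ℕ) (M : ℝ), ((n : ℝ) + 1) * N < (a * M) ^ 3 → Literature.MathematicalPhysics.QuantumManyBody.BoseGas.condensateNumber (Set.indicator (Set.Iic 1) (fun _ : ℝ => (⊤ : ENNReal))) N (a * M) ≤ Literature.MathematicalPhysics.QuantumManyBody.BoseGas.condensateNumber (Set.indicator (Set.Iic 1) (fun _ : ℝ => (⊤ : ENNReal))) N M) :=
  Birth.stub_smallRatio_of Birth.stub_oneSidedBaire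
    (Birth.stub_leftLowerSemicontinuous_of Birth.stub_diamRightContinuity) h

/-- **Item 11886 ⟹ uniform small-ratio monotonicity** (of course; recorded for symmetry).
[folklore] -/
theorem smallRatioBoxMonotone_of_hardSphereBoxMonotone (h : HardSphereBoxMonotone) :
    (∃ (n : ℕ) (a₀ : ℝ), 0 < a₀ ∧ ∀ a : ℝ, 0 < a → a ≤ a₀ → ∀ (N : ℕ) (M : ℝ), ((n : ℝ) + 1) * N < (a * M) ^ 3 → Literature.MathematicalPhysics.QuantumManyBody.BoseGas.condensateNumber (Set.indicator (Set.Iic 1) (fun _ : ℝ => (⊤ : ENNReal))) N (a * M) ≤ Literature.MathematicalPhysics.QuantumManyBody.BoseGas.condensateNumber (Set.indicator (Set.Iic 1) (fun _ : ℝ => (⊤ : ENNReal))) N M) :=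
  smallRatioBoxMonotone_of_perRatio (perRatioBoxMonotone_of_hardSphereBoxMonotone h)

/-- **Item 11884 restricted to hard spheres ⟹ UNIFORM small-ratio dilute box monotonicity**:
the hard-sphere comparison conjecture `HardCoreDominates`, whose guard depends on the ratio,
already yields one guard for all small dilation ratios (Baire + left-LSC). [folklore] -/
theorem smallRatioBoxMonotone_of_hardCoreDominates (h : HardCoreDominates) :
    (∃ (n : ℕ) (a₀ : ℝ), 0 < a₀ ∧ ∀ a : ℝ, 0 < a → a ≤ a₀ → ∀ (N : ℕ) (M : ℝ), ((n : ℝ) + 1) * N < (a * M) ^ 3 → Literature.MathematicalPhysics.QuantumManyBody.BoseGas.condensateNumber (Set.indicator (Set.Iic 1) (fun _ : ℝ => (⊤ : ENNReal))) N (a * M) ≤ Literature.MathematicalPhysics.QuantumManyBody.BoseGas.condensateNumber (Set.indicator (Set.Iic 1) (fun _ : ℝ => (⊤ : ENNReal))) N M) :=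
  smallRatioBoxMonotone_of_perRatio (perRatioBoxMonotone_of_hardCoreDominates h)

/-! ## Interval propagation of ground-state BEC in the density -/

/-- **Interval propagation from uniform small-ratio box monotonicity**: if for some `n` and
`a₀ > 0` every ratio `a ∈ (0, a₀]` has `cn(HS₁, N, aM) ≤ cn(HS₁, N, M)` whenever
`(n+1)N < (aM)³`, then below `η₀ := 1/(2(n+1))` ground-state BEC of unit hard spheres at ONE
reduced density `η` gives it on the whole initial interval `(0, a₀³ η]` (same constant): along
`L_N(η) = a · L_N(η')`, `a := (η'/η)^{1/3} ≤ a₀`, the guard `(n+1)N < L_N(η)³ = N/η` is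
`η < 1/(n+1)` for `N ≥ 1`. [folklore] -/
theorem intervalPropagation_of_smallRatio
    (h : (∃ (n : ℕ) (a₀ : ℝ), 0 < a₀ ∧ ∀ a : ℝ, 0 < a → a ≤ a₀ → ∀ (N : ℕ) (M : ℝ), ((n : ℝ) + 1) * N < (a * M) ^ 3 → Literature.MathematicalPhysics.QuantumManyBody.BoseGas.condensateNumber (Set.indicator (Set.Iic 1) (fun _ : ℝ => (⊤ : ENNReal))) N (a * M) ≤ Literature.MathematicalPhysics.QuantumManyBody.BoseGas.condensateNumber (Set.indicator (Set.Iic 1) (fun _ : ℝ => (⊤ : ENNReal))) N M)) :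
    ∃ η₀ : ℝ, 0 < η₀ ∧ ∀ η : ℝ, 0 < η → η ≤ η₀ →
      HasGroundStateBEC (Set.indicator (Set.Iic 1) (fun _ : ℝ => (⊤ : ENNReal))) η →
      ∃ η₁ : ℝ, 0 < η₁ ∧ ∀ η' : ℝ, 0 < η' → η' ≤ η₁ →
        HasGroundStateBEC (Set.indicator (Set.Iic 1) (fun _ : ℝ => (⊤ : ENNReal))) η' := by
  obtain ⟨n, a₀, ha₀, hmono⟩ := h
  have hn1 : (0 : ℝ) < (n : ℝ) + 1 := by positivity
  refine ⟨1 / (2 * ((n : ℝ) + 1)), by positivity, fun η hη hηle hBEC => ?_⟩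
  obtain ⟨c, hc, hev⟩ := hBEC
  refine ⟨a₀ ^ 3 * η, by positivity, fun η' hη' hη'le => ⟨c, hc, ?_⟩⟩
  -- the ratio `a := (η'/η)^{1/3} ∈ (0, a₀]` with `a³ = η'/η`
  set a : ℝ := (η' / η) ^ (1 / 3 : ℝ) with ha_def
  have hq : 0 < η' / η := div_pos hη' hη
  have ha : 0 < a := Real.rpow_pos_of_pos hq _
  have ha3 : a ^ 3 = η' / η := by
    rw [ha_def, ← Real.rpow_natCast, ← Real.rpow_mul hq.le]
    norm_num
  have hale : a ≤ a₀ := by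
    have h1 : η' / η ≤ a₀ ^ 3 := by
      rw [div_le_iff₀ hη]; exact hη'le
    have h2 : a ≤ (a₀ ^ 3) ^ (1 / 3 : ℝ) := Real.rpow_le_rpow hq.le h1 (by norm_num)
    rwa [← Real.rpow_natCast, ← Real.rpow_mul ha₀.le, show ((3 : ℕ) : ℝ) * (1 / 3 : ℝ) = 1 by
      norm_num, Real.rpow_one] at h2
  -- `L_N(η) = a · L_N(η')`
  have hside : ∀ N : ℕ, sideLength η N = a * sideLength η' N := by
    intro N
    have hηa : η = η' * (a⁻¹) ^ 3 := by
      rw [inv_pow, ha3]; field_simp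
    rw [hηa, sideLength_mul_pow_three hη' (inv_pos.2 ha) N, div_eq_mul_inv, inv_inv, mul_comm]
  filter_upwards [hev, eventually_gt_atTop 0] with N hN hNpos
  have hguard : ((n : ℝ) + 1) * N < (a * sideLength η' N) ^ 3 := by
    rw [← hside N, Cruxes.HardSphereBEC.sideLength_pow_three hη N, lt_div_iff₀ hη]
    have hNr : (0 : ℝ) < N := Nat.cast_pos.2 hNpos
    have hη2 : η * (2 * ((n : ℝ) + 1)) ≤ 1 := by
      rwa [le_div_iff₀ (by positivity)] at hηle
    nlinarith
  calc ENNReal.ofReal (c * N)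
      ≤ condensateNumber (Set.indicator (Set.Iic 1) (fun _ : ℝ => (⊤ : ENNReal))) N
          (sideLength η N) := hN
    _ = condensateNumber (Set.indicator (Set.Iic 1) (fun _ : ℝ => (⊤ : ENNReal))) N
          (a * sideLength η' N) := by rw [hside N]
    _ ≤ condensateNumber (Set.indicator (Set.Iic 1) (fun _ : ℝ => (⊤ : ENNReal))) N
          (sideLength η' N) := hmono a ha hale N _ hguard

/-- **Interval propagation from per-ratio monotonicity** (`smallRatioBoxMonotone_of_perRatio` +
`intervalPropagation_of_smallRatio`): BEC of unit hard spheres at one small reduced density gives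
BEC on an initial interval of densities. [folklore] -/
theorem intervalPropagation_of_perRatio
    (h : (∃ lo hi : ℝ, 0 < lo ∧ lo < hi ∧ hi < 1 ∧ ∀ a : ℝ, lo < a → a < hi → ∃ η₀ : ℝ, 0 < η₀ ∧ ∀ (N : ℕ) (L : ℝ), (N : ℝ) ≤ η₀ * L ^ 3 → Literature.MathematicalPhysics.QuantumManyBody.BoseGas.condensateNumber (Set.indicator (Set.Iic 1) (fun _ : ℝ => (⊤ : ENNReal))) N L ≤ Literature.MathematicalPhysics.QuantumManyBody.BoseGas.condensateNumber (Set.indicator (Set.Iic 1) (fun _ : ℝ => (⊤ : ENNReal))) N (L / a))) :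
    ∃ η₀ : ℝ, 0 < η₀ ∧ ∀ η : ℝ, 0 < η → η ≤ η₀ →
      HasGroundStateBEC (Set.indicator (Set.Iic 1) (fun _ : ℝ => (⊤ : ENNReal))) η →
      ∃ η₁ : ℝ, 0 < η₁ ∧ ∀ η' : ℝ, 0 < η' → η' ≤ η₁ →
        HasGroundStateBEC (Set.indicator (Set.Iic 1) (fun _ : ℝ => (⊤ : ENNReal))) η' :=
  intervalPropagation_of_smallRatio (smallRatioBoxMonotone_of_perRatio h)

/-! ## The crux body from the two open inputs of the line -/

/-- Zero-mode occupation `≥ cN` of all near-minimisers, eventually in `N`, gives ground-state BEC at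
that density (`bec_of_zeroMode` pattern: `⟨φ₀, γ_Ψ φ₀⟩ ≤ λ_max(γ_Ψ)` for the measurable
normalised constant mode, then `le_condensateNumber`). [folklore] -/
theorem hasGroundStateBEC_of_zeroMode' {v : ℝ → ENNReal} {η c : ℝ} (hη : 0 < η) (hc : 0 < c)
    (hev : ∀ᶠ N : ℕ in Filter.atTop, ∃ δ : ENNReal, 0 < δ ∧
      ∀ Ψ : TrialState N (sideLength η N), energy v Ψ ≤ groundStateEnergy v N (sideLength η N) + δ →
        ENNReal.ofReal (c * N) ≤ occupation N ((box (sideLength η N)).indicator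
          fun _ => ((Real.sqrt (sideLength η N ^ 3))⁻¹ : ℂ)) Ψ.ψ) :
    HasGroundStateBEC v η := by
  refine ⟨c, hc, ?_⟩
  filter_upwards [hev, eventually_gt_atTop 0] with N hN hNpos
  obtain ⟨δ, hδ, hΨ⟩ := hN
  have hL : 0 < sideLength η N :=
    Real.rpow_pos_of_pos (div_pos (Nat.cast_pos.mpr hNpos) hη) _
  exact le_condensateNumber v hδ fun Ψ hE =>
    (hΨ Ψ hE).trans (occupation_le_maxOccupation _
      (_root_.AtomisticToContinuum.BECInfraredBound.aestronglyMeasurable_constMode _)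
      (_root_.AtomisticToContinuum.BECInfraredBound.lintegral_constMode_sq hL))

/-- Scale transport along the hard-sphere family: unit-diameter BEC at reduced density `ρ a³` is
diameter-`a` BEC at density `ρ` (`hardSphereScaling_proof` and `L_N(ρ)/a = L_N(ρ a³)`).
[folklore] -/
theorem hasGroundStateBEC_hardSphere_of_unit' {a ρ : ℝ} (ha : 0 < a) (hρ : 0 < ρ)
    (h : HasGroundStateBEC (Set.indicator (Set.Iic 1) (fun _ : ℝ => (⊤ : ENNReal))) (ρ * a ^ 3)) :
    HasGroundStateBEC (Set.indicator (Set.Iic a) (fun _ : ℝ => (⊤ : ENNReal))) ρ := by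
  obtain ⟨c, hc, hev⟩ := h
  refine ⟨c, hc, ?_⟩
  filter_upwards [hev] with N hN
  rw [hardSphereScaling_proof a (sideLength ρ N) N ha, ← sideLength_mul_pow_three hρ ha N]
  exact hN

/-- **The crux body from the two open inputs of the line** — the sparse infrared bound (the
registered stub `stub_infraredBound`: item 11888 `HardSphereZeroMode` weakened to sparse
densities, in infrared form) and per-ratio dilute box monotonicity on an open interval of ratios
(⟸ 11886, ⟸ 11884): per-ratio monotonicity gives interval propagation
below a threshold `η₀` (`intervalPropagation_of_perRatio`); the sparse infrared bound at that
threshold gives one density `η ≤ η₀` with zero-mode BEC (`sparseZeroMode_of_infraredBound`,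
`hasGroundStateBEC_of_zeroMode'`); propagation fills `(0, η₁]`; for diameter `a` take
`ρ₀ := η₁/a³` and transport by scaling.  The conclusion is the body of the route decl
`HardSphereBEC`, verbatim. [folklore] -/
theorem hardSphereBEC_body_of_infraredBound_of_perRatio
    (h1 : ∀ η₀ : ℝ, 0 < η₀ → ∃ η : ℝ, 0 < η ∧ η ≤ η₀ ∧ ∃ c : ℝ, 0 < c ∧ ∀ᶠ N : ℕ in Filter.atTop, ∃ δ : ENNReal, 0 < δ ∧ ∀ Ψ : Literature.MathematicalPhysics.QuantumManyBody.BoseGas.TrialState N (Literature.MathematicalPhysics.QuantumManyBody.BoseGas.sideLength η N), Literature.MathematicalPhysics.QuantumManyBody.BoseGas.energy (Set.indicator (Set.Iic 1) (fun _ : ℝ => (⊤ : ENNReal))) Ψ ≤ Literature.MathematicalPhysics.QuantumManyBody.BoseGas.groundStateEnergy (Set.indicator (Set.Iic 1) (fun _ : ℝ => (⊤ : ENNReal))) N (Literature.MathematicalPhysics.QuantumManyBody.BoseGas.sideLength η N) + δ → Literature.MathematicalPhysics.QuantumManyBody.NeumannBox.nPlusLow (Real.sqrt (32 * Real.pi *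 η / c) * Literature.MathematicalPhysics.QuantumManyBody.BoseGas.sideLength η N) (Literature.MathematicalPhysics.QuantumManyBody.BoseGas.sideLength η N) N Ψ.ψ + ENNReal.ofReal (2 * c * N) ≤ (N : ENNReal))
    (h2 : (∃ lo hi : ℝ, 0 < lo ∧ lo < hi ∧ hi < 1 ∧ ∀ a : ℝ, lo < a → a < hi → ∃ η₀ : ℝ, 0 < η₀ ∧ ∀ (N : ℕ) (L : ℝ), (N : ℝ) ≤ η₀ * L ^ 3 → Literature.MathematicalPhysics.QuantumManyBody.BoseGas.condensateNumber (Set.indicator (Set.Iic 1) (fun _ : ℝ => (⊤ : ENNReal))) N L ≤ Literature.MathematicalPhysics.QuantumManyBody.BoseGas.condensateNumber (Set.indicator (Set.Iic 1) (fun _ : ℝ => (⊤ : ENNReal))) N (L / a))) :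
    ∀ a : ℝ, 0 < a → ∃ ρ₀ : ℝ, 0 < ρ₀ ∧ ∀ ρ : ℝ, 0 < ρ → ρ < ρ₀ → Literature.MathematicalPhysics.QuantumManyBody.BoseGas.HasGroundStateBEC (Set.indicator (Set.Iic a) (fun _ : ℝ => (⊤ : ENNReal))) ρ := by
  intro a ha
  obtain ⟨η₀, hη₀, hprop⟩ := intervalPropagation_of_perRatio h2
  obtain ⟨η, hη, hηle, c, hc, hev⟩ := sparseZeroMode_of_infraredBound h1 η₀ hη₀
  have hBEC : HasGroundStateBEC (Set.indicator (Set.Iic 1) (fun _ : ℝ => (⊤ : ENNReal))) η :=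
    hasGroundStateBEC_of_zeroMode' hη hc hev
  obtain ⟨η₁, hη₁, hall⟩ := hprop η hη hηle hBEC
  have ha3 : 0 < a ^ 3 := pow_pos ha 3
  refine ⟨η₁ / a ^ 3, div_pos hη₁ ha3, fun ρ hρ hρlt => ?_⟩
  have hρa : 0 < ρ * a ^ 3 := mul_pos hρ ha3
  have hρalt : ρ * a ^ 3 < η₁ := (lt_div_iff₀ ha3).1 hρlt
  exact hasGroundStateBEC_hardSphere_of_unit' ha hρ (hall (ρ * a ^ 3) hρa hρalt.le)

/-- **Corollary: the crux from 11888-weak and 11884|hard spheres** — `HardCoreDominates` may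
replace `HardSphereBoxMonotone` as the monotone input of the crux line (uniformity being free);
conclusion = the body of the route decl `HardSphereBEC`, verbatim.
[folklore] -/
theorem hardSphereBEC_body_of_infraredBound_of_hardCoreDominates
    (h1 : ∀ η₀ : ℝ, 0 < η₀ → ∃ η : ℝ, 0 < η ∧ η ≤ η₀ ∧ ∃ c : ℝ, 0 < c ∧ ∀ᶠ N : ℕ in Filter.atTop, ∃ δ : ENNReal, 0 < δ ∧ ∀ Ψ : Literature.MathematicalPhysics.QuantumManyBody.BoseGas.TrialState N (Literature.MathematicalPhysics.QuantumManyBody.BoseGas.sideLength η N), Literature.MathematicalPhysics.QuantumManyBody.BoseGas.energy (Set.indicator (Set.Iic 1) (fun _ : ℝ => (⊤ : ENNReal))) Ψ ≤ Literature.MathematicalPhysics.QuantumManyBody.BoseGas.groundStateEnergy (Set.indicator (Set.Iic 1) (fun _ : ℝ => (⊤ : ENNReal))) N (Literature.MathematicalPhysics.QuantumManyBody.BoseGas.sideLength η N) + δ → Literature.MathematicalPhysics.QuantumManyBody.NeumannBox.nPlusLow (Real.sqrt (32 * Real.pi * η / c) * Literature.MathematicalPhysics.QuantumManyBody.BoseGas.sideLength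 η N) (Literature.MathematicalPhysics.QuantumManyBody.BoseGas.sideLength η N) N Ψ.ψ + ENNReal.ofReal (2 * c * N) ≤ (N : ENNReal))
    (h2 : HardCoreDominates) :
    ∀ a : ℝ, 0 < a → ∃ ρ₀ : ℝ, 0 < ρ₀ ∧ ∀ ρ : ℝ, 0 < ρ → ρ < ρ₀ → Literature.MathematicalPhysics.QuantumManyBody.BoseGas.HasGroundStateBEC (Set.indicator (Set.Iic a) (fun _ : ℝ => (⊤ : ENNReal))) ρ :=
  hardSphereBEC_body_of_infraredBound_of_perRatio h1 (perRatioBoxMonotone_of_hardCoreDominates h2)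

end Summit.AtomisticToContinuum.BoseEinsteinCondensation.Cruxes.HardSphereBEC

end
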